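import Summits.BirchSwinnertonDyer.BirchSwinnertonDyer.Theorems.KatoDescentTamePotSupersingularTameUpperLayerZeroDoor
import Summits.BirchSwinnertonDyer.BirchSwinnertonDyer.Theorems.KatoDescentTamePotSupersingularTameUpperUnitTwistRecordsFlat87
import Summits.BirchSwinnertonDyer.BirchSwinnertonDyer.Theorems.KatoDescentTamePotSupersingularTameUpperUnitTwistRecordsFlat45
import Summits.BirchSwinnertonDyer.BirchSwinnertonDyer.Theorems.KatoDescentTamePotSupersingularTameUpperUnitTwistRecordsFlat46
import HarnessLib

/-!
# Route `KatoDescentTamePotSupersingular` (rung K8, sub-rung B4 (t′), cell `bsd-potss`): U₀ RECORDS at `p = 5` FROM THE LAYER-0 ISOTYPIC INPUT (c2*)₀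
# for three `5Nn` rows where BOTH the μ-road and the rank-equality road are shut (44100bh1, 195075bs1, 195075k1)

Seat `bsd-potss-k8t-c4` g26; `--supports stmt-BirchSwinnertonDyer-19982 --as helper`. THEOREMS ONLY (no definition, no named fact, no `sorry`);
nothing booked; (A), Conjecture A and BSD are proved for NO curve here; items 19202 / 19982 stay OPEN at class level (open inputs class-wide: zeta
crux 24439, lower half of 19984).

These rows have `5 ∣ h(ℚ(P))` (μ-road UNCOVERABLE, conjA-anchor g12) and `rank_5 Cl(ℚ(P)) > rank_5 Cl(ℚ(x(P)))` (rank-equality road shut, k8t-c4 g26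
kit j333672).  The layer-0 isotypic census (kit j334168: g25's engine — permutation characters of all subgroup classes of `C_ns⁺(5) = C₂₄ ⋊ C₂` and the
`5`-ranks of all fixed fields of degree `≤ 24`) shows that `Cl(ℚ(E[5])) ⊗ 𝔽̄₅` is a SINGLE two-dimensional constituent of order `24` (one of the four
twists `E[5] ⊗ χ`, `χ⁴ = 1`); the eigenvalue test (kit j334241: the automorphism `P ↦ 2P` of `ℚ(P)`, i.e. the central element acting as the scalar `2`
on `E[5]`, acts on `Cl(ℚ(P))[5]` by `−2`; validated on the controls 396900b1/d1 where it acts by `−1` on the even constituent) identifies it as a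
QUARTIC twist, `≠ E[5]`, so (c2*)₀ «`Hom_{Γ_ℚ}(Cl(𝓞_{ℚ(E[5])}), E[5]) = 0`» holds numerically (GRH for the degree-24 class group).  Per row:
`MissingUpperBoundAt E 5` from `hKatoA hGZK hmod`, Cremona's `r_an = 0`, the basis data and the DISPLAYED input `h0` = (c2*)₀, through
`TameRankEqRecords.missingUpperBoundAt_five_tame_of_nonsplitCartanBasis_of_homTrivial_layerZero` (k8t-c4 g26: door L6 in inertia form, (c1) and
(c3*) automatic for `C_ns⁺(5)`).  For the other 9 shut `5Nn` rows (119025ck1, 176400fa1, 243675bt1, 313600cd1, 313600ce1, 435600iz1, 476100bv1 and the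
second class of 396900eb1/ed1) the test returns `+2`: the constituent is `E[5]` or `E^d[5]` (`ℚ(√d)` = the quadratic subfield of `ℚ(P)`) — undecided
at degree 24 (needs the Galois action on `Cl(ℚ(E[5]))[5]`, degree 48).  CONDITIONAL; per row; nothing booked; BSD for no curve.

References: [Kato2004Asterisque] Thm. 14.5 (3); [CoatesSujatha2005] Thm. 3.4; [DeoRaySujatha2023] Thm. 3.8; [Washington1997] §13; [Cremona2006] Table 1.
-/

set_option autoImplicit false
-- the Theorems directory repeats the summit name (`Summits/BirchSwinnertonDyer/BirchSwinnertonDyer/…`): house rule of the cell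
set_option linter.dupNamespace false

noncomputable section

open scoped Classical NumberField Matrix
open WeierstrassCurve Field IntermediateField
  Literature.NumberTheory.EllipticCurves Literature.NumberTheory.EllipticCurves.Rank1Residual
  Literature.NumberTheory.EllipticCurves.Rank1Residual.Typed
  Literature.NumberTheory.GaloisRepresentations Literature.NumberTheory.SerreUniformity
  Literature.NumberTheory.IwasawaTheory Literature.NumberTheory.NumberFields
  Summit.BirchSwinnertonDyer.Rank1Residual Summit.BirchSwinnertonDyer.Rank1Residual.Additive
  Summit.BirchSwinnertonDyer.BirchSwinnertonDyer.Theorems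

namespace Summit.BirchSwinnertonDyer.BirchSwinnertonDyer.Theorems.TameRankEqRecords

/-! ### `44100bh1` @ `p = 5` — `N = 44100 = 2^2·3^2·5^2·7^2`; Cremona: `r_an = 0`; (t′) at `5` (Kodaira II, e = 6); ♭; mod-`5` image `5Nn` (displayed); the rank-equality road is
SHUT here (`rank_5 Cl(ℚ(P)) = 1 > rank_5 Cl(ℚ(x(P))) = 0`: `h(ℚ(P)) = 20` [GRH], `h(ℚ(x(P))) = 1` [CERT], kit j333672).  Layer-0 isotypic numerics: every leaf of
`ℚ(E[5])` of degree `≤ 16` has `5`-rank `0` and `ℚ(P)` has `5`-rank `1` (kit j334168), so `Cl(ℚ(E[5])) ⊗ 𝔽̄_5` is ONE two-dimensional constituent `D` of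
order `24`; the automorphism `P ↦ 2P` of `ℚ(P)` acts on `Cl(ℚ(P))[5]` by `3 = −2` (kit j334241, class group `[10, 2]` under GRH), so `D` is a QUARTIC twist of
`E[5]` and `D ≠ E[5]`: (c2*)₀ holds numerically. -/

/-- **CONDITIONAL U₀ for `44100bh1` @ 5 FROM THE LAYER-0 ISOTYPIC INPUT** — `ord₅ #Ш(E) ≤ ord₅ #Ш_an(E)` (`MissingUpperBoundAt E 5`) for
`E = 44100bh1 = [0, 0, 0, -25725, 1596665]` (`N = 2^2·3^2·5^2·7^2`), from: the named facts `hKatoA hGZK hmod`; Cremona's `r_an = 0` (`hr`); the `C_ns⁺(ε)` basis data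
(`e hε he σx hσx`, displayed); the layer-0 isotypic input `h0` «every additive `Γ_ℚ`-equivariant `Cl(𝓞_{ℚ(E[5])}) → E[5]` is zero» (displayed;
numerically: the `5`-part of `Cl(ℚ(E[5]))` is a single `2`-dimensional constituent on which `P ↦ 2P` acts by `−2`, a quartic twist of `E[5]`,
kits j334168 + j334241, GRH).  NO `μ`-hypothesis, NO inertia / decomposition hypothesis.  KERNEL: `E[5]` irreducible, `Addv`, `SubTprime`
(tree: `TameUpperUnitTwistRecords.irr_g44100bh1_5`, `addv_g44100bh1_5`, `subTprime_g44100bh1_5`); (c1), (c3*) of door L6 automatic.  This row was UNCOVERABLE by the μ-road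
(`5 ∣ h(ℚ(P))`) and by the rank-equality road.  Per row; CONDITIONAL; nothing booked; BSD is not proved by this.
[cite: Kato2004Asterisque, Thm. 14.5 (3) (p. 236)] [cite: CoatesSujatha2005, §3 Thm. 3.4] [cite: DeoRaySujatha2023, §3 Thm. 3.8 (arXiv:2202.09937 p. 9)]
[cite: Cremona2006, Table 1 (Cremona label 44100bh1)] -/
theorem missingUpperBoundAt_g44100bh1_5_of_homTrivial_layerZero
    (hKatoA : Kato2004.rankZero_padicValNat_sha_add_padicValNat_tamagawa_le_of_additive_potGood_of_irreducible_of_fineSelmerDual_fg)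
    (hGZK : rank_eq_analyticRank_of_analyticRank_le_one) (hmod : hasEntireLFunction_rat)
    {W : WeierstrassCurve ℚ} [W.IsElliptic] [W.IsGloballyMinimal] (hWeq : W = (⟨0, 0, 0, (-25725), 1596665⟩ : WeierstrassCurve ℚ))
    (hr : W.analyticRank = 0)
    (e : W.geomTorsion (5 : ℕ) ≃+ (Fin 2 → ZMod 5)) {ε : ZMod 5} (hε : ¬ IsSquare ε)
    (he : ∀ σ : absoluteGaloisGroup ℚ, ∃ M ∈ nonsplitCartanNormalizer ε, ∀ P : W.geomTorsion (5 : ℕ), e (σ • P) = M *ᵥ e P)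
    (σx : absoluteGaloisGroup ℚ) (hσx : ∀ P : W.geomTorsion (5 : ℕ), e (σx • P) = !![1, ε * (4 - ε); 4 - ε, 1] *ᵥ e P)
    (h0 : ∀ μ : Additive (ClassGroup (𝓞 ↥(W.divisionField 5))) →+ W.geomTorsion (5 : ℕ),
      (∀ (τ : absoluteGaloisGroup ℚ) (c : ClassGroup (𝓞 ↥(W.divisionField 5))),
        μ (Additive.ofMul (ClassGroup.mulEquiv
          (AmbiguousClass.intAut (absRestrictNormalHom (W.divisionField 5) τ)) c)) = τ • μ (Additive.ofMul c)) → μ = 0) :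
    MissingUpperBoundAt W 5 := by
  subst hWeq
  exact missingUpperBoundAt_five_tame_of_nonsplitCartanBasis_of_homTrivial_layerZero _ hKatoA hGZK hmod hr
    TameUpperUnitTwistRecords.addv_g44100bh1_5 TameUpperUnitTwistRecords.subTprime_g44100bh1_5 TameUpperUnitTwistRecords.irr_g44100bh1_5
    e hε he σx hσx h0

/-! ### `195075bs1` @ `p = 5` — `N = 195075 = 3^3·5^2·17^2`; Cremona: `r_an = 0`; (t′) at `5` (Kodaira IV*, e = 3); ♭; mod-`5` image `5Nn` (displayed); the rank-equality road is
SHUT here (`rank_5 Cl(ℚ(P)) = 1 > rank_5 Cl(ℚ(x(P))) = 0`: `h(ℚ(P)) = 10` [GRH], `h(ℚ(x(P))) = 1` [CERT], kit j333672).  Layer-0 isotypic numerics: every leaf of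
`ℚ(E[5])` of degree `≤ 16` has `5`-rank `0` and `ℚ(P)` has `5`-rank `1` (kit j334168), so `Cl(ℚ(E[5])) ⊗ 𝔽̄_5` is ONE two-dimensional constituent `D` of
order `24`; the automorphism `P ↦ 2P` of `ℚ(P)` acts on `Cl(ℚ(P))[5]` by `3 = −2` (kit j334241, class group `[10]` under GRH), so `D` is a QUARTIC twist of
`E[5]` and `D ≠ E[5]`: (c2*)₀ holds numerically. -/

/-- **CONDITIONAL U₀ for `195075bs1` @ 5 FROM THE LAYER-0 ISOTYPIC INPUT** — `ord₅ #Ш(E) ≤ ord₅ #Ш_an(E)` (`MissingUpperBoundAt E 5`) for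
`E = 195075bs1 = [1, -1, 0, -33867, 680166]` (`N = 3^3·5^2·17^2`), from: the named facts `hKatoA hGZK hmod`; Cremona's `r_an = 0` (`hr`); the `C_ns⁺(ε)` basis data
(`e hε he σx hσx`, displayed); the layer-0 isotypic input `h0` «every additive `Γ_ℚ`-equivariant `Cl(𝓞_{ℚ(E[5])}) → E[5]` is zero» (displayed;
numerically: the `5`-part of `Cl(ℚ(E[5]))` is a single `2`-dimensional constituent on which `P ↦ 2P` acts by `−2`, a quartic twist of `E[5]`,
kits j334168 + j334241, GRH).  NO `μ`-hypothesis, NO inertia / decomposition hypothesis.  KERNEL: `E[5]` irreducible, `Addv`, `SubTprime`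
(tree: `TameUpperUnitTwistRecords.irr_g195075bs1_5`, `addv_g195075bs1_5`, `subTprime_g195075bs1_5`); (c1), (c3*) of door L6 automatic.  This row was UNCOVERABLE by the μ-road
(`5 ∣ h(ℚ(P))`) and by the rank-equality road.  Per row; CONDITIONAL; nothing booked; BSD is not proved by this.
[cite: Kato2004Asterisque, Thm. 14.5 (3) (p. 236)] [cite: CoatesSujatha2005, §3 Thm. 3.4] [cite: DeoRaySujatha2023, §3 Thm. 3.8 (arXiv:2202.09937 p. 9)]
[cite: Cremona2006, Table 1 (Cremona label 195075bs1)] -/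
theorem missingUpperBoundAt_g195075bs1_5_of_homTrivial_layerZero
    (hKatoA : Kato2004.rankZero_padicValNat_sha_add_padicValNat_tamagawa_le_of_additive_potGood_of_irreducible_of_fineSelmerDual_fg)
    (hGZK : rank_eq_analyticRank_of_analyticRank_le_one) (hmod : hasEntireLFunction_rat)
    {W : WeierstrassCurve ℚ} [W.IsElliptic] [W.IsGloballyMinimal] (hWeq : W = (⟨1, (-1), 0, (-33867), 680166⟩ : WeierstrassCurve ℚ))
    (hr : W.analyticRank = 0)
    (e : W.geomTorsion (5 : ℕ) ≃+ (Fin 2 → ZMod 5)) {ε : ZMod 5} (hε : ¬ IsSquare ε)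
    (he : ∀ σ : absoluteGaloisGroup ℚ, ∃ M ∈ nonsplitCartanNormalizer ε, ∀ P : W.geomTorsion (5 : ℕ), e (σ • P) = M *ᵥ e P)
    (σx : absoluteGaloisGroup ℚ) (hσx : ∀ P : W.geomTorsion (5 : ℕ), e (σx • P) = !![1, ε * (4 - ε); 4 - ε, 1] *ᵥ e P)
    (h0 : ∀ μ : Additive (ClassGroup (𝓞 ↥(W.divisionField 5))) →+ W.geomTorsion (5 : ℕ),
      (∀ (τ : absoluteGaloisGroup ℚ) (c : ClassGroup (𝓞 ↥(W.divisionField 5))),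
        μ (Additive.ofMul (ClassGroup.mulEquiv
          (AmbiguousClass.intAut (absRestrictNormalHom (W.divisionField 5) τ)) c)) = τ • μ (Additive.ofMul c)) → μ = 0) :
    MissingUpperBoundAt W 5 := by
  subst hWeq
  exact missingUpperBoundAt_five_tame_of_nonsplitCartanBasis_of_homTrivial_layerZero _ hKatoA hGZK hmod hr
    TameUpperUnitTwistRecords.addv_g195075bs1_5 TameUpperUnitTwistRecords.subTprime_g195075bs1_5 TameUpperUnitTwistRecords.irr_g195075bs1_5
    e hε he σx hσx h0

/-! ### `195075k1` @ `p = 5` — `N = 195075 = 3^3·5^2·17^2`; Cremona: `r_an = 0`; (t′) at `5` (Kodaira II, e = 6); ♭; mod-`5` image `5Nn` (displayed); the rank-equality road is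
SHUT here (`rank_5 Cl(ℚ(P)) = 1 > rank_5 Cl(ℚ(x(P))) = 0`: `h(ℚ(P)) = 10` [GRH], `h(ℚ(x(P))) = 1` [CERT], kit j333672).  Layer-0 isotypic numerics: every leaf of
`ℚ(E[5])` of degree `≤ 16` has `5`-rank `0` and `ℚ(P)` has `5`-rank `1` (kit j334168), so `Cl(ℚ(E[5])) ⊗ 𝔽̄_5` is ONE two-dimensional constituent `D` of
order `24`; the automorphism `P ↦ 2P` of `ℚ(P)` acts on `Cl(ℚ(P))[5]` by `3 = −2` (kit j334241, class group `[10]` under GRH), so `D` is a QUARTIC twist of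
`E[5]` and `D ≠ E[5]`: (c2*)₀ holds numerically. -/

/-- **CONDITIONAL U₀ for `195075k1` @ 5 FROM THE LAYER-0 ISOTYPIC INPUT** — `ord₅ #Ш(E) ≤ ord₅ #Ш_an(E)` (`MissingUpperBoundAt E 5`) for
`E = 195075k1 = [1, -1, 1, -1355, 5712]` (`N = 3^3·5^2·17^2`), from: the named facts `hKatoA hGZK hmod`; Cremona's `r_an = 0` (`hr`); the `C_ns⁺(ε)` basis data
(`e hε he σx hσx`, displayed); the layer-0 isotypic input `h0` «every additive `Γ_ℚ`-equivariant `Cl(𝓞_{ℚ(E[5])}) → E[5]` is zero» (displayed;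
numerically: the `5`-part of `Cl(ℚ(E[5]))` is a single `2`-dimensional constituent on which `P ↦ 2P` acts by `−2`, a quartic twist of `E[5]`,
kits j334168 + j334241, GRH).  NO `μ`-hypothesis, NO inertia / decomposition hypothesis.  KERNEL: `E[5]` irreducible, `Addv`, `SubTprime`
(tree: `TameUpperUnitTwistRecords.irr_g195075k1_5`, `addv_g195075k1_5`, `subTprime_g195075k1_5`); (c1), (c3*) of door L6 automatic.  This row was UNCOVERABLE by the μ-road
(`5 ∣ h(ℚ(P))`) and by the rank-equality road.  Per row; CONDITIONAL; nothing booked; BSD is not proved by this.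
[cite: Kato2004Asterisque, Thm. 14.5 (3) (p. 236)] [cite: CoatesSujatha2005, §3 Thm. 3.4] [cite: DeoRaySujatha2023, §3 Thm. 3.8 (arXiv:2202.09937 p. 9)]
[cite: Cremona2006, Table 1 (Cremona label 195075k1)] -/
theorem missingUpperBoundAt_g195075k1_5_of_homTrivial_layerZero
    (hKatoA : Kato2004.rankZero_padicValNat_sha_add_padicValNat_tamagawa_le_of_additive_potGood_of_irreducible_of_fineSelmerDual_fg)
    (hGZK : rank_eq_analyticRank_of_analyticRank_le_one) (hmod : hasEntireLFunction_rat)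
    {W : WeierstrassCurve ℚ} [W.IsElliptic] [W.IsGloballyMinimal] (hWeq : W = (⟨1, (-1), 1, (-1355), 5712⟩ : WeierstrassCurve ℚ))
    (hr : W.analyticRank = 0)
    (e : W.geomTorsion (5 : ℕ) ≃+ (Fin 2 → ZMod 5)) {ε : ZMod 5} (hε : ¬ IsSquare ε)
    (he : ∀ σ : absoluteGaloisGroup ℚ, ∃ M ∈ nonsplitCartanNormalizer ε, ∀ P : W.geomTorsion (5 : ℕ), e (σ • P) = M *ᵥ e P)
    (σx : absoluteGaloisGroup ℚ) (hσx : ∀ P : W.geomTorsion (5 : ℕ), e (σx • P) = !![1, ε * (4 - ε); 4 - ε, 1] *ᵥ e P)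
    (h0 : ∀ μ : Additive (ClassGroup (𝓞 ↥(W.divisionField 5))) →+ W.geomTorsion (5 : ℕ),
      (∀ (τ : absoluteGaloisGroup ℚ) (c : ClassGroup (𝓞 ↥(W.divisionField 5))),
        μ (Additive.ofMul (ClassGroup.mulEquiv
          (AmbiguousClass.intAut (absRestrictNormalHom (W.divisionField 5) τ)) c)) = τ • μ (Additive.ofMul c)) → μ = 0) :
    MissingUpperBoundAt W 5 := by
  subst hWeq
  exact missingUpperBoundAt_five_tame_of_nonsplitCartanBasis_of_homTrivial_layerZero _ hKatoA hGZK hmod hr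
    TameUpperUnitTwistRecords.addv_g195075k1_5 TameUpperUnitTwistRecords.subTprime_g195075k1_5 TameUpperUnitTwistRecords.irr_g195075k1_5
    e hε he σx hσx h0

end Summit.BirchSwinnertonDyer.BirchSwinnertonDyer.Theorems.TameRankEqRecords

end
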